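import Literature.Computability.AlgebraicComplexity.Forbes15SmallSupportMonomials
import HarnessLib

/-!
# FSV 2018 Thm. 37 and the `Σm∧ΣΠ^{O(1)}` bullet of Thm. 9 — the named facts DISCHARGED

M. A. Forbes, A. Shpilka, B. L. Volk, *Succinct hitting sets and barriers to proving lower bounds
for algebraic circuits*, Theory of Computing 14 (2018) (= arXiv:1701.05328), **Thm. 37** (seq.
numbering; = ToC Thm. 5.13, p. 27): «there is a poly(log s, n)-ΣΠΣ succinct generator for
`Σm∧ΣΠ^{O(1)}` formulas of top fan-in `s`», printed proof (arXiv p. 19, L72–): Lemma 36 (a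
full-support shift has a monomial of support `O(log s)`) + Lemma 31 (the generator `G^{SSSV}`
hits polynomials with a small-support monomial) + Fact 30 (succinctness); and **Thm. 9** (= ToC
Thm. 1.10, p. 15), bullet 4, which restates Thm. 37 as a succinct hitting set.

Both named facts (`FSV2018_thm37`, `FSV2018_thm9_smesp`, file `FSV18SuccinctGenerators`, text of
record = val-lit pass 4: the hit class carries the clause `ringChar F = 0 ∨ P.totalDegree <
ringChar F` of the cited source [Forbes 2015, Prop. 6.5 / Cor. 6.7] behind Lemma 36 — equal to
print in characteristic `0`, weaker otherwise) were already PROVED MODULO Lemma 36 in that file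
(`FSV2018_thm37_of_lemma36`, with Lemma 31 discharged there, and `FSV2018_thm9_smesp_of_thm37`);
Lemma 36 is now a theorem (`FSV2018_lemma36_holds`, file `Forbes15SmallSupportMonomials`,
val-lit p1), so both facts are discharged here by name.  Theorems only; no new definitions or
facts.  Honest framing: kernel-checked glue between a printed external theorem and the typed FSV
statements; VP ≠ VNP is not proved and nothing here is progress on it.
-/

namespace Literature.Computability.AlgebraicComplexity

/-- **FSV Thm. 37 (ToC Thm. 5.13) — the named fact `FSV2018_thm37` DISCHARGED:** for every bottom
degree `t` a uniform exponent `c` such that over every field and all `n, s` there is a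
hitting-set generator for the `Σm∧ΣΠ^t` formulas `P` of top fan-in `s` with
`char F = 0 ∨ deg P < char F`, succinct for read-once affine product sums of top fan-in
`≤ (⌊log₂ s⌋ + 2)^c`.  Proof as printed: Lemma 36 (`FSV2018_lemma36_holds`) + Lemma 31 + Fact 30
(`FSV2018_thm37_of_lemma36`).
[cite: ForbesShpilkaVolk2018, Thm. 37 (seq.) = ToC Thm. 5.13, p. 27; Forbes2015, Prop. 6.5 / Cor. 6.7 (characteristic clause)]
locator: paper:arxiv-1701.05328 p0019.txt:L72; paper:doi-10-4086-toc-2018-v014a018 p0027.txt:L2 -/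
theorem FSV2018_thm37_holds : FSV2018_thm37 :=
  FSV2018_thm37_of_lemma36 FSV2018_lemma36_holds

/-- **FSV Thm. 9 (ToC Thm. 1.10), bullet `Σm∧ΣΠ^{O(1)}` — the named fact `FSV2018_thm9_smesp`
DISCHARGED:** for every `t` a uniform `c` such that over every infinite field the `Σm∧ΣΠ^t`
formulas `P` of top fan-in `s` in the `2^n` coefficient variables with `char F = 0 ∨ deg P < char F`
have a multilinear `poly(log s, n)`-`ΣΠΣ`-succinct hitting set of size parameter
`(⌊log₂ s⌋ + n + 2)^c`.  Proof as printed: Thm. 37 (`FSV2018_thm37_holds`) via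
`FSV2018_thm9_smesp_of_thm37`.
[cite: ForbesShpilkaVolk2018, Thm. 9 (seq.) = ToC Thm. 1.10, p. 15, bullet 4; Thm. 37 = ToC Thm. 5.13]
locator: paper:arxiv-1701.05328 p0011.txt:L10; paper:doi-10-4086-toc-2018-v014a018 p0015.txt:L5 -/
theorem FSV2018_thm9_smesp_holds : FSV2018_thm9_smesp :=
  FSV2018_thm9_smesp_of_thm37 FSV2018_thm37_holds

end Literature.Computability.AlgebraicComplexity
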